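import Summits.ResolutionOfSingularities.ResolutionOfSingularities.Theorems.RadicialJungCleanModelsStubCossartPiltant2019InvariantCofinality
import Summits.ResolutionOfSingularities.ResolutionOfSingularities.Theorems.RadicialJungCleanModelsStubCossartPiltant2019OfLeavesClosed
import HarnessLib

/-!
# `CleanModels`, stub 2 (F-02): BOTH research leaves `hEqT`, `hEqI` from ONE statement — INVARIANT COFINALITY — and the TYPE of stub 2
# from {CP 2019 Thm. 1.5, stub 1, invariant cofinality, Hironaka (char 0)}

OURS (decomp-res hand-1 g20; crux `stmt-ResolutionOfSingularities-15917`, skeleton rev 35 `Cruxes/CleanModels/Lines/Sketch.lean`, stub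
`stub_cossartPiltant2019 : CossartPiltant2019.{0}`).  A BOOKKEEPING + TOOL file continuing
`RadicialJungCleanModelsStubCossartPiltant2019{StabilityCriterion,InvariantCofinality}.lean` (same generation) and hand-1 g19's
`RadicialJungCleanModelsStubCossartPiltant2019OfLeavesClosed.lean`.

Hand-1 g15–g19 isolated the non-printed content of Cossart–Piltant 2019's reduction `Thm. 1.5 ⇒ Thm. 1.1` (Prop. 4.10, via [CoP1] §9) as two
EQUIVARIANT local-uniformization statements `hEqT` (tame layer, [CoP1] Lemma 9.4 «S is stable by G») and `hEqI` (inertia layer, [CoP1]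
Prop. 9.3).  Both ask for a local uniformization whose LOCAL RING is stable under a group `H` of `S`-automorphisms of the ambient field
mapping the subfield `M′` into itself and `O_E ∩ M′` into `O_E` (plus layer-specific side conditions, plus one prescribed element `x₀` in the
inertia layer).  By `exists_stableLU_of_invariantCofinality` (companion file) both follow from ONE statement with no group-stability
language, INVARIANT COFINALITY (`hICof` below): «in that frame, every local uniformization `t` of `M′` and every finite `e ⊆ O_E ∩ M′`
admit a local uniformization `t′ ⊇ t` of `M′` whose NEW generators are FIXED by `H` and whose local ring contains `e`» — local
uniformization reached by adjoining INVARIANT elements (elements of the lower field of the layer) only.  Plain cofinality (new generators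
anywhere in `O_E ∩ M′`) is the tree's `cofinality_of_principalization` (CP 2019 Prop. 4.4, proved); the word INVARIANT is the entire
research content of stub 2 below CP 2019 Thm. 1.5 and CJS 2020 Thm. 1.4.

* `equivariantLU_of_invariantCofinality : hICof → hEqT ∧ hEqI`;
* `cossartPiltant2019ReductionP_of_stub1_of_invariantCofinality : CossartPiltant2019Local.{0} → CossartJannsenSaito2020Embedded.{0} → hICof →
  CossartPiltant2019ReductionP.{0}` (through `cossartPiltant2019ReductionP_of_embPrinted_of_equivariantLU_split`, principalization proved);
* `cossartPiltant2019_of_stub1_of_invariantCofinality_of_hironaka` — **the TYPE of stub 2 from `CossartPiltant2019Local.{0}`,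
  `CossartJannsenSaito2020Embedded.{0}` (= stub 1), `hICof`, `Hironaka1964_local.{0}` (char. `0` only)**.

`hICof` is quantified over ALL pairs `(M′, H)` of the frame (it is applied only at the tame and inertia groups); it is a consequence of
CP 2019 Thm. 1.1 itself (cofinality along the fixed field), so it is not a strengthening beyond what the crux already presumes.  Nothing here
proves resolution of singularities in positive characteristic, local uniformization in dimension three, or any statement of a manuscript
under adjudication; rung 0. AI-written; AI review weaker than expert review.
-/

-- `Summit.<Summit>.<Sub>.Theorems` with `Sub = Summit` (single-conjunct summit, D-0017)
set_option linter.dupNamespace false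

noncomputable section

open IsLocalRing Polynomial AlgebraicGeometry
open _root_.IntermediateField
open Literature.AlgebraicGeometry.Resolution
open Summit.ResolutionOfSingularities.ResolutionOfSingularities.Theorems.CP2008Prop44
open Summit.ResolutionOfSingularities.ResolutionOfSingularities.Theorems.RadicialJung.CleanModels.StabilityCriterion

namespace Summit.ResolutionOfSingularities.ResolutionOfSingularities.Theorems.RadicialJung.CleanModels

/-- **Both equivariant local uniformizations of Cossart–Piltant's climb — `hEqT` (tame layer) and `hEqI` (inertia layer, cofinal in one
element `x₀`) — from invariant cofinality.**  The layer-specific hypotheses (residually trivial action of exponent `ℓ ≠ p` with the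
displacement condition; residually faithful action) are not used: `exists_stableLU_of_invariantCofinality` with `e₀ = ∅`, resp. `e₀ = {x₀}`.
Stated as a conjunction (the two members are verbatim the hypotheses `hEqT`, `hEqI` of
`cossartPiltant2019ReductionP_of_embPrinted_of_equivariantLU_split`). [folklore]
[cite: CossartPiltant2008, proofs of Prop. 9.3 and Lemma 9.4 (HAL hal-00139124 pp. 27, 29)] [cite: CossartPiltant2019, proof of Prop. 4.10 (arXiv v1 Prop. 4.8, p. 54)] -/
theorem equivariantLU_of_invariantCofinality
    (hICof :
      ∀ (p : ℕ), p.Prime →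
      ∀ (S : Type) [CommRing S] [IsDomain S] [IsRegularLocalRing S],
        IsExcellentRing S → ringKrullDim S = 3 → CharP (ResidueField S) p →
        IsAdicComplete (maximalIdeal S) S →
      ∀ (E : Type) [Field E] [Algebra S E], Function.Injective (algebraMap S E) →
        IsAlgClosed E → Algebra.IsAlgebraic S E →
      ∀ (OE : ValuationSubring E), (∀ s : S, algebraMap S E s ∈ OE) →
        (∀ s ∈ maximalIdeal S, OE.valuation (algebraMap S E s) < 1) →
        (∀ y : OE, ∃ q : S[X], (∃ i, q.coeff i ∉ maximalIdeal S) ∧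
          OE.valuation (q.eval₂ (algebraMap S E) y) < 1) →
      Nonempty OE.valuation.RankOne →
      ∀ (M' : Subfield E), (∀ s : S, algebraMap S E s ∈ M') →
      ∀ (H : Subgroup (E ≃ₐ[S] E)),
        (∀ σ ∈ H, ∀ x ∈ M', σ x ∈ M') →
        (∀ σ ∈ H, ∀ x ∈ M', x ∈ OE → σ x ∈ OE) →
        ∀ (t : Finset E), (t : Set E) ⊆ M' →
          M' ≤ Subfield.closure (Set.range (algebraMap S E) ∪ (t : Set E)) →
          (∃ hTO : (Algebra.adjoin S (t : Set E)).toSubring ≤ OE.toSubring,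
            IsRegularLocalRing (Localization.AtPrime
              (Ideal.comap (Subring.inclusion hTO) (maximalIdeal OE)))) →
        ∀ (e : Finset E), (e : Set E) ⊆ M' → (∀ x ∈ e, x ∈ OE) →
        ∃ t' : Finset E, t ⊆ t' ∧ (t' : Set E) ⊆ M' ∧ (∀ σ ∈ H, ∀ x ∈ t', x ∉ t → σ x = x) ∧
          ∃ hTO' : (Algebra.adjoin S (t' : Set E)).toSubring ≤ OE.toSubring,
            IsRegularLocalRing (Localization.AtPrime
              (Ideal.comap (Subring.inclusion hTO') (maximalIdeal OE))) ∧
            ∀ x ∈ e, x ∈ locAtCentre (Algebra.adjoin S (t' : Set E)).toSubring OE) :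
    (∀ (p : ℕ), p.Prime →
      ∀ (S : Type) [CommRing S] [IsDomain S] [IsRegularLocalRing S],
        IsExcellentRing S → ringKrullDim S = 3 → CharP (ResidueField S) p →
        IsAdicComplete (maximalIdeal S) S →
      ∀ (E : Type) [Field E] [Algebra S E], Function.Injective (algebraMap S E) →
        IsAlgClosed E → Algebra.IsAlgebraic S E →
      ∀ (OE : ValuationSubring E), (∀ s : S, algebraMap S E s ∈ OE) →
        (∀ s ∈ maximalIdeal S, OE.valuation (algebraMap S E s) < 1) →
        (∀ y : OE, ∃ q : S[X], (∃ i, q.coeff i ∉ maximalIdeal S) ∧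
          OE.valuation (q.eval₂ (algebraMap S E) y) < 1) →
      Nonempty OE.valuation.RankOne →
      ∀ (M' : Subfield E), (∀ s : S, algebraMap S E s ∈ M') →
      ∀ (H : Subgroup (E ≃ₐ[S] E)),
        (∀ σ ∈ H, ∀ x ∈ M', σ x ∈ M') →
        (∀ σ ∈ H, ∀ x ∈ M', x ∈ OE → σ x ∈ OE) →
        (∀ σ ∈ H, ∀ x ∈ M', x ∈ OE → OE.valuation (σ x - x) < 1) →
        (∃ ℓ : ℕ, ℓ.Prime ∧ ℓ ≠ p ∧ ∀ σ ∈ H, ∀ x ∈ M', (σ ^ ℓ) x = x) →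
        (∀ σ ∈ H, (∃ x ∈ M', σ x ≠ x) →
          ∃ x ∈ M', x ≠ 0 ∧ OE.valuation (σ x - x) = OE.valuation x) →
        (∃ t : Finset E, (t : Set E) ⊆ M' ∧
          M' ≤ Subfield.closure (Set.range (algebraMap S E) ∪ (t : Set E)) ∧
          ∃ hTO : (Algebra.adjoin S (t : Set E)).toSubring ≤ OE.toSubring,
            IsRegularLocalRing (Localization.AtPrime
              (Ideal.comap (Subring.inclusion hTO) (maximalIdeal OE)))) →
        ∃ t : Finset E, (t : Set E) ⊆ M' ∧
          M' ≤ Subfield.closure (Set.range (algebraMap S E) ∪ (t : Set E)) ∧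
          ∃ hTO : (Algebra.adjoin S (t : Set E)).toSubring ≤ OE.toSubring,
            IsRegularLocalRing (Localization.AtPrime
              (Ideal.comap (Subring.inclusion hTO) (maximalIdeal OE))) ∧
            (∀ σ ∈ H, ∀ x ∈ locAtCentre (Algebra.adjoin S (t : Set E)).toSubring OE,
              σ x ∈ locAtCentre (Algebra.adjoin S (t : Set E)).toSubring OE)) ∧
    (∀ (p : ℕ), p.Prime →
      ∀ (S : Type) [CommRing S] [IsDomain S] [IsRegularLocalRing S],
        IsExcellentRing S → ringKrullDim S = 3 → CharP (ResidueField S) p →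
        IsAdicComplete (maximalIdeal S) S →
      ∀ (E : Type) [Field E] [Algebra S E], Function.Injective (algebraMap S E) →
        IsAlgClosed E → Algebra.IsAlgebraic S E →
      ∀ (OE : ValuationSubring E), (∀ s : S, algebraMap S E s ∈ OE) →
        (∀ s ∈ maximalIdeal S, OE.valuation (algebraMap S E s) < 1) →
        (∀ y : OE, ∃ q : S[X], (∃ i, q.coeff i ∉ maximalIdeal S) ∧
          OE.valuation (q.eval₂ (algebraMap S E) y) < 1) →
      Nonempty OE.valuation.RankOne →
      ∀ (M' : Subfield E), (∀ s : S, algebraMap S E s ∈ M') →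
      ∀ (H : Subgroup (E ≃ₐ[S] E)),
        (∀ σ ∈ H, ∀ x ∈ M', σ x ∈ M') →
        (∀ σ ∈ H, ∀ x ∈ M', x ∈ OE → σ x ∈ OE) →
        (∀ σ ∈ H, (∃ x ∈ M', σ x ≠ x) →
          ∃ x ∈ M', OE.valuation x = 1 ∧ OE.valuation (σ x - x) = 1) →
      ∀ (x₀ : E), x₀ ∈ M' → x₀ ∈ OE →
        (∃ t : Finset E, (t : Set E) ⊆ M' ∧
          M' ≤ Subfield.closure (Set.range (algebraMap S E) ∪ (t : Set E)) ∧
          ∃ hTO : (Algebra.adjoin S (t : Set E)).toSubring ≤ OE.toSubring,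
            IsRegularLocalRing (Localization.AtPrime
              (Ideal.comap (Subring.inclusion hTO) (maximalIdeal OE)))) →
        ∃ t : Finset E, (t : Set E) ⊆ M' ∧
          M' ≤ Subfield.closure (Set.range (algebraMap S E) ∪ (t : Set E)) ∧
          ∃ hTO : (Algebra.adjoin S (t : Set E)).toSubring ≤ OE.toSubring,
            IsRegularLocalRing (Localization.AtPrime
              (Ideal.comap (Subring.inclusion hTO) (maximalIdeal OE))) ∧
            (∀ σ ∈ H, ∀ x ∈ locAtCentre (Algebra.adjoin S (t : Set E)).toSubring OE,
              σ x ∈ locAtCentre (Algebra.adjoin S (t : Set E)).toSubring OE) ∧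
            x₀ ∈ locAtCentre (Algebra.adjoin S (t : Set E)).toSubring OE) := by
  refine ⟨?_, ?_⟩
  · intro p hp S _ _ _ hS hSdim hSchar hScomp E _ _ hinj hE halg OE hSO hdom hres hrk M' hSM' H hHM hHO
      _hres' _hexp _hdisp hLU
    obtain ⟨t, htM, hMt, hTO, hreg, hstab, -⟩ :=
      exists_stableLU_of_invariantCofinality (S := S) (E := E) hinj OE M' hSM' H hHM hHO hLU ∅ (by simp)
        (by simp)
        (hICof p hp S hS hSdim hSchar hScomp E hinj hE halg OE hSO hdom hres hrk M' hSM' H hHM hHO)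
    exact ⟨t, htM, hMt, hTO, hreg, hstab⟩
  · intro p hp S _ _ _ hS hSdim hSchar hScomp E _ _ hinj hE halg OE hSO hdom hres hrk M' hSM' H hHM hHO
      _hfaith x₀ hx₀M hx₀O hLU
    obtain ⟨t, htM, hMt, hTO, hreg, hstab, hx⟩ :=
      exists_stableLU_of_invariantCofinality (S := S) (E := E) hinj OE M' hSM' H hHM hHO hLU {x₀}
        (by simpa using hx₀M) (by simpa using hx₀O)
        (hICof p hp S hS hSdim hSchar hScomp E hinj hE halg OE hSO hdom hres hrk M' hSM' H hHM hHO)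
    exact ⟨t, htM, hMt, hTO, hreg, hstab, hx x₀ (by simp)⟩

/-- **`CossartPiltant2019ReductionP` from `CossartPiltant2019Local` (CP 2019 Thm. 1.5), stub 1 (CJS Thm. 1.4), and invariant cofinality.**
`cossartPiltant2019ReductionP_of_embPrinted_of_equivariantLU_split` (principalization `CossartPiltant2019Principalization_holds` proved in the
tree) fed with the two members of `equivariantLU_of_invariantCofinality`.
[cite: CossartPiltant2019, Thm. 1.5, Props. 4.3, 4.4 and proof of Prop. 4.10 (arXiv v1: Props. 4.2, 4.3, 4.8, pp. 50–54)]
[cite: CossartPiltant2008, Prop. 9.3, Lemma 9.4, Prop. 9.5 (HAL hal-00139124 pp. 26–30)] [cite: CossartJannsenSaito2020, Thm. 1.4, Cor. 1.5] -/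
theorem cossartPiltant2019ReductionP_of_stub1_of_invariantCofinality
    (hloc : CossartPiltant2019Local.{0}) (hCJSE : CossartJannsenSaito2020Embedded.{0})
    (hICof :
      ∀ (p : ℕ), p.Prime →
      ∀ (S : Type) [CommRing S] [IsDomain S] [IsRegularLocalRing S],
        IsExcellentRing S → ringKrullDim S = 3 → CharP (ResidueField S) p →
        IsAdicComplete (maximalIdeal S) S →
      ∀ (E : Type) [Field E] [Algebra S E], Function.Injective (algebraMap S E) →
        IsAlgClosed E → Algebra.IsAlgebraic S E →
      ∀ (OE : ValuationSubring E), (∀ s : S, algebraMap S E s ∈ OE) →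
        (∀ s ∈ maximalIdeal S, OE.valuation (algebraMap S E s) < 1) →
        (∀ y : OE, ∃ q : S[X], (∃ i, q.coeff i ∉ maximalIdeal S) ∧
          OE.valuation (q.eval₂ (algebraMap S E) y) < 1) →
      Nonempty OE.valuation.RankOne →
      ∀ (M' : Subfield E), (∀ s : S, algebraMap S E s ∈ M') →
      ∀ (H : Subgroup (E ≃ₐ[S] E)),
        (∀ σ ∈ H, ∀ x ∈ M', σ x ∈ M') →
        (∀ σ ∈ H, ∀ x ∈ M', x ∈ OE → σ x ∈ OE) →
        ∀ (t : Finset E), (t : Set E) ⊆ M' →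
          M' ≤ Subfield.closure (Set.range (algebraMap S E) ∪ (t : Set E)) →
          (∃ hTO : (Algebra.adjoin S (t : Set E)).toSubring ≤ OE.toSubring,
            IsRegularLocalRing (Localization.AtPrime
              (Ideal.comap (Subring.inclusion hTO) (maximalIdeal OE)))) →
        ∀ (e : Finset E), (e : Set E) ⊆ M' → (∀ x ∈ e, x ∈ OE) →
        ∃ t' : Finset E, t ⊆ t' ∧ (t' : Set E) ⊆ M' ∧ (∀ σ ∈ H, ∀ x ∈ t', x ∉ t → σ x = x) ∧
          ∃ hTO' : (Algebra.adjoin S (t' : Set E)).toSubring ≤ OE.toSubring,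
            IsRegularLocalRing (Localization.AtPrime
              (Ideal.comap (Subring.inclusion hTO') (maximalIdeal OE))) ∧
            ∀ x ∈ e, x ∈ locAtCentre (Algebra.adjoin S (t' : Set E)).toSubring OE) :
    CossartPiltant2019ReductionP.{0} :=
  cossartPiltant2019ReductionP_of_embPrinted_of_equivariantLU_split hloc CossartPiltant2019Principalization_holds hCJSE
    (equivariantLU_of_invariantCofinality hICof).1 (equivariantLU_of_invariantCofinality hICof).2

/-- **The TYPE of stub 2, `CossartPiltant2019.{0}`, from `CossartPiltant2019Local.{0}` (CP 2019 Thm. 1.5), `CossartJannsenSaito2020Embedded.{0}`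
(CJS Thm. 1.4 = stub 1), INVARIANT COFINALITY (`hICof`), and `Hironaka1964_local.{0}` (used only at characteristic `0`).**  As hand-1 g19's
`cossartPiltant2019_of_stub1_of_equivariantLU_of_hironaka` with its two research leaves `hEqT`, `hEqI` discharged from `hICof`.
[cite: CossartPiltant2019, Thm. 1.1, Thm. 1.5, Props. 4.4, 4.6, 4.8, 4.10] [cite: CossartPiltant2008, Prop. 9.3, Lemma 9.4, Prop. 9.5]
[cite: CossartJannsenSaito2020, Thm. 1.2, Thm. 1.4, Cor. 1.5] [cite: Temkin2008, Thm. 1.1] [cite: NovacoskiSpivakovsky2014, Thm. 1.1, Cor. 2.17, §3.1] -/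
theorem cossartPiltant2019_of_stub1_of_invariantCofinality_of_hironaka
    (hloc : CossartPiltant2019Local.{0}) (hCJSE : CossartJannsenSaito2020Embedded.{0})
    (hICof :
      ∀ (p : ℕ), p.Prime →
      ∀ (S : Type) [CommRing S] [IsDomain S] [IsRegularLocalRing S],
        IsExcellentRing S → ringKrullDim S = 3 → CharP (ResidueField S) p →
        IsAdicComplete (maximalIdeal S) S →
      ∀ (E : Type) [Field E] [Algebra S E], Function.Injective (algebraMap S E) →
        IsAlgClosed E → Algebra.IsAlgebraic S E →
      ∀ (OE : ValuationSubring E), (∀ s : S, algebraMap S E s ∈ OE) →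
        (∀ s ∈ maximalIdeal S, OE.valuation (algebraMap S E s) < 1) →
        (∀ y : OE, ∃ q : S[X], (∃ i, q.coeff i ∉ maximalIdeal S) ∧
          OE.valuation (q.eval₂ (algebraMap S E) y) < 1) →
      Nonempty OE.valuation.RankOne →
      ∀ (M' : Subfield E), (∀ s : S, algebraMap S E s ∈ M') →
      ∀ (H : Subgroup (E ≃ₐ[S] E)),
        (∀ σ ∈ H, ∀ x ∈ M', σ x ∈ M') →
        (∀ σ ∈ H, ∀ x ∈ M', x ∈ OE → σ x ∈ OE) →
        ∀ (t : Finset E), (t : Set E) ⊆ M' →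
          M' ≤ Subfield.closure (Set.range (algebraMap S E) ∪ (t : Set E)) →
          (∃ hTO : (Algebra.adjoin S (t : Set E)).toSubring ≤ OE.toSubring,
            IsRegularLocalRing (Localization.AtPrime
              (Ideal.comap (Subring.inclusion hTO) (maximalIdeal OE)))) →
        ∀ (e : Finset E), (e : Set E) ⊆ M' → (∀ x ∈ e, x ∈ OE) →
        ∃ t' : Finset E, t ⊆ t' ∧ (t' : Set E) ⊆ M' ∧ (∀ σ ∈ H, ∀ x ∈ t', x ∉ t → σ x = x) ∧
          ∃ hTO' : (Algebra.adjoin S (t' : Set E)).toSubring ≤ OE.toSubring,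
            IsRegularLocalRing (Localization.AtPrime
              (Ideal.comap (Subring.inclusion hTO') (maximalIdeal OE))) ∧
            ∀ x ∈ e, x ∈ locAtCentre (Algebra.adjoin S (t' : Set E)).toSubring OE)
    (hH : Hironaka1964_local.{0}) : CossartPiltant2019.{0} :=
  cossartPiltant2019_of_stub1_of_equivariantLU_of_hironaka hloc hCJSE
    (equivariantLU_of_invariantCofinality hICof).1 (equivariantLU_of_invariantCofinality hICof).2 hH

end Summit.ResolutionOfSingularities.ResolutionOfSingularities.Theorems.RadicialJung.CleanModels

/-! ## Erratum (hand-1 g20, same generation)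

Two sentences of the module docstring above are WITHDRAWN: «the word INVARIANT is the entire research content of stub 2 …» and «`hICof` … is a
consequence of CP 2019 Thm. 1.1 itself (cofinality along the fixed field), so it is not a strengthening beyond what the crux already presumes».
The GLOBAL hypothesis `hICof` (= `InvariantCofinality3` of `…OfNamedInvariantCofinality.lean`) is FALSE: for `S = k[[x,y,z]]`, the monomial
valuation `V = (1, √2, √3)`, `M′ = F(x^{1/ℓ})`, the local uniformization `t = {x^{1/ℓ}}` and `e = (y/z)·x^{(ℓ−1)/ℓ} ∈ O_E ∩ M′`, no enlargement of
`t` by `Gal`-INVARIANT generators has `e` in its local ring (coefficient-valuation argument, `…OfNamedInvariantCofinality.lean` § Erratum 2).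
Hence `equivariantLU_of_invariantCofinality`, `cossartPiltant2019ReductionP_of_stub1_of_invariantCofinality` and
`cossartPiltant2019_of_stub1_of_invariantCofinality_of_hironaka` are correct but have an unsatisfiable hypothesis.  What survives: the
INSTANCE-LEVEL reduction `StabilityCriterion.exists_stableLU_of_invariantCofinality` (invariant cofinality asked only for the `(t, e)` at
hand, which does hold in many instances) and the research leaves `hEqT` / `hEqI` themselves, equivalently the printed pair
`CossartPiltant2008_lemma94_kummerCore` / `CossartPiltant2008_prop93` (`…PushDownOfEquivariantLU.lean`).
-/

namespace Summit.ResolutionOfSingularities.ResolutionOfSingularities.Theorems.RadicialJung.CleanModels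

/-- **Erratum carrier**: the global invariant-cofinality hypothesis `hICof` of this file is unsatisfiable (counterexample in
`…OfNamedInvariantCofinality.lean` § Erratum 2); see the module section «Erratum» above. [OURS, bookkeeping] -/
theorem equivariantLU_of_invariantCofinality.hypothesis_unsatisfiable_note : True := trivial

end Summit.ResolutionOfSingularities.ResolutionOfSingularities.Theorems.RadicialJung.CleanModels

end
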